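import Summits.Ventures.PercRepro.C026TwoCluster

/-!
# The two-hub skeleton: the attachment `H = G⁺ + {h–a, h–b, h'–a, h'–b, a–b}` (p6, gen 22)

mine-3's THEOREM B (proofs/MINE3-G23-card.md; MINE3-GLUING.md §40 (j)) proves ROW C-041 `(G⅔)` on
every skeleton in which the two terminals `a, b` are adjacent and every other neighbour of a
terminal is one of two hubs `h, h'`, each adjacent to both terminals — the class containing every
known equality case of `(G⅔)` (the hub, the double hub / 6-core, W9).  This file builds the class:
`G.attachTwoHub a b h h'` is the multigraph `G` (the hub graph `G⁺`, in which `a` and `b` are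
vertices without edges) with the five edges `0 = h–a`, `1 = h–b`, `2 = h'–a`, `3 = h'–b`, `4 = a–b`
added (edge type `E ⊕ Fin 5`), and proves the transfer lemmas between the walks of `H` and those
of `G⁺` that STEP 1 of the theorem (the pattern reduction, `C026TwoHubSources`) runs on:

* `attachTwoHub` and its endpoint lemmas; `compl_comp_inl` (restriction commutes with the
  complement);
* `openAdj_attach_of_openAdj`, `conn_attach_of_conn` — a `G⁺`-walk is an `H`-walk;
* `eq_inl_of_ne_terminals` — an edge of `H` with no endpoint at a terminal is an edge of `G⁺`;
  `openAdj_of_openAdj_attach` — an `H`-step between non-terminals is a `G⁺`-step;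
* `exists_entry` — a walk from outside `Y` into `Y` has a first entry step;
* `walkAvoiding_attach_iff` — walks avoiding a set containing both terminals are the same in `H`
  and in `G⁺`; `WalkAvoiding.mono_set`;
* `walkAvoiding_of_conn_of_isolated`, `walkAvoiding_union_iff_of_isolated`,
  `walkAvoiding_iff_conn_of_isolated` — avoiding edgeless vertices costs nothing.
-/

namespace PercRepro

namespace MultiGraph

open Finset

variable {V E : Type*}

/-- **The two-hub attachment**: `G` (with `a`, `b` edgeless in it) plus the five edges
`0 = h–a`, `1 = h–b`, `2 = h'–a`, `3 = h'–b`, `4 = a–b`. -/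
def attachTwoHub (G : MultiGraph V E) (a b h h' : V) : MultiGraph V (E ⊕ Fin 5) where
  fst := Sum.elim G.fst ![h, h, h', h', a]
  snd := Sum.elim G.snd ![a, b, a, b, b]

variable {G : MultiGraph V E} {a b h h' : V}

/-- First endpoint of a `G`-edge in the attachment. -/
@[simp] theorem attachTwoHub_fst_inl (e : E) : (G.attachTwoHub a b h h').fst (Sum.inl e) = G.fst e :=
  rfl

/-- Second endpoint of a `G`-edge in the attachment. -/
@[simp] theorem attachTwoHub_snd_inl (e : E) : (G.attachTwoHub a b h h').snd (Sum.inl e) = G.snd e :=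
  rfl

/-- First endpoints of the five new edges. -/
@[simp] theorem attachTwoHub_fst_inr (i : Fin 5) :
    (G.attachTwoHub a b h h').fst (Sum.inr i) = ![h, h, h', h', a] i := rfl

/-- Second endpoints of the five new edges. -/
@[simp] theorem attachTwoHub_snd_inr (i : Fin 5) :
    (G.attachTwoHub a b h h').snd (Sum.inr i) = ![a, b, a, b, b] i := rfl

/-- Restriction to the `G`-edges commutes with the complement. -/
theorem compl_comp_inl {F : Type*} (S : Config (E ⊕ F)) : Sᶜ ∘ Sum.inl = (S ∘ Sum.inl)ᶜ := by
  funext e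
  rfl

/-- A `G`-step is a step of the attachment. -/
theorem openAdj_attach_of_openAdj {S : Config (E ⊕ Fin 5)} {x y : V}
    (hxy : G.OpenAdj (S ∘ Sum.inl) x y) : (G.attachTwoHub a b h h').OpenAdj S x y := by
  obtain ⟨e, he, hend⟩ := hxy
  exact ⟨Sum.inl e, he, hend⟩

/-- A `G`-connection is a connection of the attachment. -/
theorem conn_attach_of_conn {S : Config (E ⊕ Fin 5)} {x y : V}
    (hxy : G.Conn (S ∘ Sum.inl) x y) : (G.attachTwoHub a b h h').Conn S x y := by
  unfold Conn at hxy ⊢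
  induction hxy with
  | refl => exact Relation.ReflTransGen.refl
  | tail _ hst ih => exact ih.tail (openAdj_attach_of_openAdj hst)

/-- An edge of the attachment with no endpoint at a terminal is a `G`-edge. -/
theorem eq_inl_of_ne_terminals {f : E ⊕ Fin 5}
    (h1 : (G.attachTwoHub a b h h').fst f ≠ a) (h2 : (G.attachTwoHub a b h h').fst f ≠ b)
    (h3 : (G.attachTwoHub a b h h').snd f ≠ a) (h4 : (G.attachTwoHub a b h h').snd f ≠ b) :
    ∃ e, f = Sum.inl e := by
  rcases f with e | i
  · exact ⟨e, rfl⟩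
  · exfalso
    fin_cases i
    · exact h3 rfl
    · exact h4 rfl
    · exact h3 rfl
    · exact h4 rfl
    · exact h1 rfl

/-- A step of the attachment between two non-terminal vertices is a `G`-step. -/
theorem openAdj_of_openAdj_attach {S : Config (E ⊕ Fin 5)} {x y : V}
    (hxy : (G.attachTwoHub a b h h').OpenAdj S x y) (hxa : x ≠ a) (hxb : x ≠ b) (hya : y ≠ a)
    (hyb : y ≠ b) : G.OpenAdj (S ∘ Sum.inl) x y := by
  obtain ⟨f, hf, hend⟩ := hxy
  have hne : ∃ e, f = Sum.inl e := by
    rcases hend with ⟨h1, h2⟩ | ⟨h1, h2⟩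
    · exact eq_inl_of_ne_terminals (h1 ▸ hxa) (h1 ▸ hxb) (h2 ▸ hya) (h2 ▸ hyb)
    · exact eq_inl_of_ne_terminals (h1 ▸ hya) (h1 ▸ hyb) (h2 ▸ hxa) (h2 ▸ hxb)
  obtain ⟨e, rfl⟩ := hne
  exact ⟨e, hf, hend⟩

/-- **First entry**: a walk from a vertex outside `Y` to a vertex of `Y` has a step `x → w` into
`Y` preceded by a walk avoiding `Y`. -/
theorem exists_entry {α : Type*} {r : α → α → Prop} {Y : Set α} {u v : α}
    (h : Relation.ReflTransGen r u v) (hu : u ∉ Y) (hv : v ∈ Y) :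
    ∃ x, x ∉ Y ∧ ∃ w ∈ Y, Relation.ReflTransGen (fun x y => r x y ∧ y ∉ Y) u x ∧ r x w := by
  induction h using Relation.ReflTransGen.head_induction_on with
  | refl => exact absurd hv hu
  | @head u u' huu' _ ih =>
    by_cases hu' : u' ∈ Y
    · exact ⟨u, hu, u', hu', Relation.ReflTransGen.refl, huu'⟩
    · obtain ⟨x, hx, w, hw, hwalk, hxw⟩ := ih hu'
      exact ⟨x, hx, w, hw, Relation.ReflTransGen.head ⟨huu', hu'⟩ hwalk, hxw⟩

/-- Avoiding a larger set is stronger. -/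
theorem WalkAvoiding.mono_set {ω : Config E} {W W' : Set V} {u v : V} (hW : W ⊆ W')
    (h : G.WalkAvoiding ω W' u v) : G.WalkAvoiding ω W u v := by
  refine ⟨fun hu => h.1 (hW hu), ?_⟩
  exact reflTransGen_of_imp (fun _ _ hxy => ⟨hxy.1, fun hy => hxy.2 (hW hy)⟩) h.2

/-- **Walks avoiding both terminals are the same in `H` and in `G⁺`**. -/
theorem walkAvoiding_attach_iff {S : Config (E ⊕ Fin 5)} {W : Set V} (haW : a ∈ W) (hbW : b ∈ W)
    {x y : V} :
    (G.attachTwoHub a b h h').WalkAvoiding S W x y ↔ G.WalkAvoiding (S ∘ Sum.inl) W x y := by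
  constructor
  · rintro ⟨hx, hwalk⟩
    refine ⟨hx, ?_⟩
    induction hwalk using Relation.ReflTransGen.head_induction_on with
    | refl => exact Relation.ReflTransGen.refl
    | @head u u' huu' _ ih =>
      refine Relation.ReflTransGen.head ⟨?_, huu'.2⟩ (ih huu'.2)
      exact openAdj_of_openAdj_attach huu'.1 (fun h => hx (h ▸ haW)) (fun h => hx (h ▸ hbW))
        (fun h => huu'.2 (h ▸ haW)) (fun h => huu'.2 (h ▸ hbW))
  · rintro ⟨hx, hwalk⟩
    exact ⟨hx, reflTransGen_of_imp (fun _ _ hxy => ⟨openAdj_attach_of_openAdj hxy.1, hxy.2⟩) hwalk⟩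

/-- A walk from a vertex outside `W` never enters `W` when the vertices of `W` have no edges. -/
theorem walkAvoiding_of_conn_of_isolated {ω : Config E} {W : Set V}
    (hW : ∀ w ∈ W, ∀ e, G.fst e ≠ w ∧ G.snd e ≠ w) {u v : V} (hu : u ∉ W) (h : G.Conn ω u v) :
    G.WalkAvoiding ω W u v := by
  refine ⟨hu, ?_⟩
  unfold Conn at h
  induction h with
  | refl => exact Relation.ReflTransGen.refl
  | @tail x y _ hxy ih =>
    refine ih.tail ⟨hxy, fun hy => ?_⟩
    obtain ⟨e, _, hend⟩ := hxy
    rcases hend with ⟨_, h2⟩ | ⟨h1, _⟩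
    · exact (hW y hy e).2 h2
    · exact (hW y hy e).1 h1

/-- Avoiding edgeless vertices in addition costs nothing. -/
theorem walkAvoiding_union_iff_of_isolated {ω : Config E} {W K : Set V}
    (hW : ∀ w ∈ W, ∀ e, G.fst e ≠ w ∧ G.snd e ≠ w) {u v : V} (hu : u ∉ W) :
    G.WalkAvoiding ω (W ∪ K) u v ↔ G.WalkAvoiding ω K u v := by
  constructor
  · exact WalkAvoiding.mono_set Set.subset_union_right
  · rintro ⟨huK, hwalk⟩
    refine ⟨fun hmem => hmem.elim hu huK, ?_⟩
    refine reflTransGen_of_imp (fun x y hxy => ⟨hxy.1, fun hy => hy.elim (fun hyW => ?_) hxy.2⟩) hwalk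
    obtain ⟨e, _, hend⟩ := hxy.1
    rcases hend with ⟨_, h2⟩ | ⟨h1, _⟩
    · exact (hW y hyW e).2 h2
    · exact (hW y hyW e).1 h1

/-- Avoiding only edgeless vertices is plain connectivity. -/
theorem walkAvoiding_iff_conn_of_isolated {ω : Config E} {W : Set V}
    (hW : ∀ w ∈ W, ∀ e, G.fst e ≠ w ∧ G.snd e ≠ w) {u v : V} (hu : u ∉ W) :
    G.WalkAvoiding ω W u v ↔ G.Conn ω u v :=
  ⟨WalkAvoiding.conn, walkAvoiding_of_conn_of_isolated hW hu⟩

end MultiGraph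

end PercRepro
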